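import Summits.CriticalPhenomena.PercolationContinuityZ3.Theorems.Transplant.SkelFrmBChoiceDefs3
import HarnessLib

/-!
# N2 (frames-only node `SamePDropOfSkeletonFrm₁`, OPEN), (R) column: THE GLUE — `RootHoldsNQWFnL Lf (frmChoiceAllQ3 …)` FROM THE TWO ROOT LEGS AT
# THE CHOICE FUNCTION OF RECORD, LENGTH-BUDGETED, FLAT ROOT TABLE

Twin of N1's `SkelNeg1RootGlueTA` (`rootHoldsNOWFnL_negChoiceAllOTA_of_xy`) for the N2 choice function of record `frmChoiceAllQ3 gv fv Pv Sv cv bv` (SkelFrmBChoiceDefs3,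
J11/(R-33): Step-I‴ accuracy at the cube; six slots, (R-31)) and the FORWARD root residue `Skel.RootOblTWF` (SkelRootSeedLawF p340132): by `Skel.rootOblTWF_of_axes` (p346773) the
(R) Prop of the closure of record (`PlanarSkeletonFrm.RootHoldsNQWFnL Lf`, SkelFrm1ChoiceDefs p340645) follows from ONE root leg per axis `a : Fin 2` at the
premise `AtQNQ`, each in the shape the legs of record conclude (`Skelφ.rootChainF_of_kgCorr` / `rootChainF_of_kgCorrY`, SkelPhiRootLegKG: chain length
EXPOSED and `≤ Lf κ.K₀`, every accuracy at the FLAT value `κ.δr 0`) — the flat table `FlatQ Lf κ` (handed down by the closure) rewrites `κ.δr n = κ.δr 0`.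
builds on p205010 (kernel theorem, internal audit signed; external expert review pending) — nothing in this file uses p205010; nothing here is a claim about
the open node `SamePDropOfSkeletonFrm₁`.
Lane `prim-bschramm`, seat `prim-bschramm-p3` (gen 16; N2 design owner, (R) column owner); helper file (`--supports stmt-CriticalPhenomena-4575 --as helper`).
[cite: KozmaNitzan2024, §4 p. 28 ((32) at the root), Theorem 6 (pp. 25–31): the order of constants]
-/

noncomputable section

open scoped Classical

namespace Summit.CriticalPhenomena.PercolationContinuityZ3.Theorems.Transplant

open MeasureTheory Literature.Probability.Percolation Literature.Probability.LatticeModels SimpleGraph KNCells KNLevels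

namespace PlanarSkeletonFrm

open SkelConc (Consts)
open Skelφ.StepI (OutNS)
open Skel (winGraph)

/-- **`RootHoldsNQWFnL Lf (frmChoiceAllQ3 …)` FROM ONE ROOT LEG PER AXIS, length-budgeted, at the flat accuracy `κ.δr 0`**: for every `(κ, G, Φ, t, p, hC, O, q)`
at the premise `AtQNQ` of the choices of record `NegB.choiceAtQ3 …`, given `Φ.types = {t}`, `0 < p < 1` and the flat table `FlatQ Lf κ`, a root leg along each
axis `a : Fin 2` — a linked chain of `n + 1 ≤ Lf κ.K₀ + 1` target steps in a window graph under a law dominated by the pinned root law inside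
`Q₀ ∪ E_{0,(a,true)}`, (S0) kits / excess / source at `κ.δr 0`, last true target in `M_{0+(a,true)}` — gives the (R) Prop of the closure of record.
[cite: KozmaNitzan2024, §4 p. 28 ((32) at the root)] -/
theorem rootHoldsNQWFnL_frmChoiceAllQ3_of_axes (Lf : ℕ → ℕ) (gv fv : Neg.FSlot) (Pv : NegB.PSlot) (Sv : NegB.SSlot) (cv : NegB.CSlot) (bv : NegB.BSlot)
    (h : ∀ (κ : Consts) {V : Type} [DecidableEq V] [Countable V] (G : SimpleGraph V) [G.LocallyFinite] (Φ : PlanarSkeletonFrm G) (t : V) (p : unitInterval)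
      (hC : Φ.CylSubcritical p) (O : OutNS V) (q : unitInterval), (NegB.choiceAtQ3 κ Φ t p Pv gv fv Sv cv bv hC).AtQNQ O q → Φ.types = {t} →
      0 < (p : ℝ) → (p : ℝ) < 1 → FlatQ Lf κ → ∀ a : Fin 2,
      ∃ n, n ≤ Lf κ.K₀ ∧ ∃ (c : V) (Rπ : ℕ) (W : Sym2 V → unitInterval) (s : Fin (n + 1) → KNLevels.TStep (winGraph G c Rπ))
        (T' : Fin (n + 1) → Finset V) (η : ℝ),
        (∀ T : Finset V, (prodBernoulli W).real (⋃ t' ∈ T, openConn (NegB.ΓQ κ Φ t p O gv fv Sv cv bv q).root t') ≤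
          (prodBernoulli (pinW (KNLevels.lattW G q) ↑((⟨NegB.ΓQ κ Φ t p O gv fv Sv cv bv q, q, κ.δ⟩ : KSchA V ℕ).U₀ G)
            ↑((⟨NegB.ΓQ κ Φ t p O gv fv Sv cv bv q, q, κ.δ⟩ : KSchA V ℕ).U₀ G))).real
            (⋃ t' ∈ (↑T : Set V), openConnIn (↑((NegB.ΓQ κ Φ t p O gv fv Sv cv bv q).Q (NegB.ΓQ κ Φ t p O gv fv Sv cv bv q).a₀ 0 ∪
              (NegB.ΓQ κ Φ t p O gv fv Sv cv bv q).Ewv (NegB.ΓQ κ Φ t p O gv fv Sv cv bv q).a₀ 0 ((a, true) : MDir)) : Set V)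
              (NegB.ΓQ κ Φ t p O gv fv Sv cv bv q).root t')) ∧
        (∀ i : Fin (n + 1), (s i).L.o = (NegB.ΓQ κ Φ t p O gv fv Sv cv bv q).root) ∧
        (∀ i : Fin n, T' (Fin.castSucc i) ⊆ (s i.succ).L.X 0) ∧ (∀ i : Fin (n + 1), T' i ⊆ (s i).T) ∧
        (∀ i : Fin (n + 1), (s i).KitsAtF W q Φ.Δ (κ.δr 0)) ∧ η ≤ κ.δr 0 / 2 ∧
        (∀ i : Fin (n + 1), (prodBernoulli W).real (⋃ t' ∈ (s i).T \ T' i, openConn (NegB.ΓQ κ Φ t p O gv fv Sv cv bv q).root t') ≤ η) ∧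
        1 - κ.δr 0 < (prodBernoulli W).real (s 0).L.reachB ∧
        T' (Fin.last n) ⊆ (NegB.ΓQ κ Φ t p O gv fv Sv cv bv q).M (NegB.ΓQ κ Φ t p O gv fv Sv cv bv q).a₀ ((0 : Site 2) + stepVec ((a, true) : MDir))) :
    RootHoldsNQWFnL Lf (frmChoiceAllQ3 gv fv Pv Sv cv bv) := by
  intro κ V _ _ G _ Φ hg t ht h1 p hp0 hp1 hC hflat O q hAt
  rw [frmChoiceAllQ3_eq] at hAt
  rw [frmChoiceAllQ3_scheme]
  refine Skel.rootOblTWF_of_axes fun a => ?_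
  obtain ⟨n, hn, c, Rπ, W, s, T', η, htr, ho, hlink, hsub, hkits, hη, hexc, hsrc, hlast⟩ := h κ G Φ t p hC O q hAt h1 hp0 hp1 hflat a
  refine ⟨n, c, Rπ, W, s, T', η, htr, ho, hlink, hsub, ?_, ?_, hexc, ?_, hlast⟩
  · rw [hflat n hn]; exact hkits
  · rw [hflat n hn]; exact hη
  · rw [hflat n hn]; exact hsrc

end PlanarSkeletonFrm

end Summit.CriticalPhenomena.PercolationContinuityZ3.Theorems.Transplant

end
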